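import Mathlib
import HarnessLib
import Summits.NavierStokesRegularity.NavierStokesRegularity.Theorems.SymmetryModuliCountAxisymEndLiouvilleOfFarPastLedgerPressure
import Summits.NavierStokesRegularity.NavierStokesRegularity.Theorems.SymmetryModuliCountAxisymEndLiouvilleOfFarPastLedgerAssembly
import Summits.NavierStokesRegularity.NavierStokesRegularity.Theorems.SymmetryModuliCountFarPastLedgerFarShell
import Summits.NavierStokesRegularity.NavierStokesRegularity.Theorems.SymmetryModuliCountFarPastLedgerCovering
import Summits.NavierStokesRegularity.NavierStokesRegularity.Theorems.SymmetryModuliCountFarPastLedgerPressureGradientBound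
import Summits.NavierStokesRegularity.NavierStokesRegularity.Theorems.SymmetryModuliCountFarPastLedgerPinning
import Summits.NavierStokesRegularity.NavierStokesRegularity.Theorems.SymmetryModuliCountFarPastLedgerMeanDisplacement

/-!
# `SymmetryModuliCount.ForcedSymmetry` (crux stmt-NavierStokesRegularity-4052), line
# `blow-down-census`, stub `stub_pressurePackage`: the pressure package of the ledger class

Support file (everything proved, kind = proof) for the lead's skeleton of the line
`blow-down-census` (`Cruxes/ForcedSymmetry/Lines/blow_down_census.lean`). The stub
`stub_pressurePackage` is, verbatim, the hypothesis `hPress` of the landed 𝒦-route blow-down driver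
`Theorems.AxisymEndLiouvilleOfFarPastLedger.exists_singular_axisymmetric_limit`
(stmt-NavierStokesRegularity-14736), with its constant `D₀` quantified after `C, K`: for every
`C, K` there is `D₀` such that every backward shift `w(· − T)`, `0 < T ≤ 1`, of a `w ∈ A_C`
(`IsTypeIAncientMild C w`) carrying the far-past energy ledger with constant `K` has a pressure `q`
making `(w(· − T), q)` a suitable weak solution in the unit parabolic ball `Q(0,1)`
(Albritton–Barker, Def. 2.1) with `∫_{Q(0,1)} |q|^{3/2} ≤ D₀`.

This file is pure ASSEMBLY of landed tree theorems, following the landed reduction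
`Theorems.AxisymEndLiouvilleOfFarPastLedger.axisymEndLiouvilleOfFarPastLedger_of_slicePressure`
(`Theorems/SymmetryModuliCountAxisymEndLiouvilleOfFarPastLedgerReduction.lean`):

* `stub_pressurePackage_of_slicePressure`: the package CONDITIONAL on the slice harmonic analysis
  of the Oseen pressure `hHA` — verbatim the registered statement of the stub
  `stub_fplSlicePressure` of the sibling crux `FarPastLedger` (stmt-NavierStokesRegularity-14060,
  line `uloc-gronwall-transplant`). Proof: the far-shell sum of the unit-ball ledger
  (`stub_fplFarShell` fed with `stub_fplCovering`), the near/far structure of the window pressure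
  at the centre `0` on the window `(−3, 0)` (`nearFar_window_of_parts` fed with
  `stub_fplPressureGradientBound`, `hHA`, `stub_fplPinning`, `stub_fplMeanDisplacement`), and the
  landed package `pressurePackage_of_nearFar`.

## References

* D. Albritton, T. Barker, *Global weak Besov solutions of the Navier–Stokes equations and
  applications*, J. Math. Fluid Mech. 21 (2019), Def. 2.1, §3. [AlbrittonBarker2019]
* G. Koch, N. Nadirashvili, G. Seregin, V. Šverák, *Liouville theorems for the Navier–Stokes
  equations and applications*, Acta Math. 203 (2009), §3–4. [KochNadirashviliSereginSverak2009]
-/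

noncomputable section

-- the summit and its single problem share the name (D-0017 nested layout)
set_option linter.dupNamespace false

open MeasureTheory Set Metric Filter Function
open scoped ENNReal NNReal

namespace Summit.NavierStokesRegularity.NavierStokesRegularity.Theorems.SymmetryModuliCountForcedSymmetry

open Literature.Analysis.FluidPDE
open Summit.NavierStokesRegularity.NavierStokesRegularity.Theorems.AxisymEndLiouvilleOfFarPastLedger
  (pressurePackage_of_nearFar nearFar_window_of_parts)

/-- **The pressure package of the ledger class, conditional on the slice-pressure lemma HA.**
If the slice harmonic analysis of the Oseen pressure holds (hypothesis `hHA`, verbatim the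
registered stub `stub_fplSlicePressure` of the crux `FarPastLedger`, stmt-NavierStokesRegularity-14060),
then for every `C, K` there is `D₀` such that every backward shift `w(· − T)`, `0 < T ≤ 1`, of a
`w ∈ A_C` with ledger constant `K` has a pressure `q` with
`IsSuitableWeakSolutionInBall 1 0 (w(· − T)) q` and `∫_{Q(0,1)} |q|^{3/2} ≤ D₀` — the hypothesis
`hPress` of the 𝒦-route driver `exists_singular_axisymmetric_limit`. Assembly: far-shell sum
(`stub_fplFarShell` + `stub_fplCovering`), near/far structure of the window pressure on `(−3, 0)`
at the centre `0` (`nearFar_window_of_parts` + `stub_fplPressureGradientBound` + `hHA` +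
`stub_fplPinning` + `stub_fplMeanDisplacement`), and `pressurePackage_of_nearFar`.
[cite: AlbrittonBarker2019, Def. 2.1 and §3; KochNadirashviliSereginSverak2009, §3–4] -/
theorem stub_pressurePackage_of_slicePressure
    (hHA : ∃ c₀ : ℝ, 0 ≤ c₀ ∧ ∀ (M L : ℝ) (w : EuclideanSpace ℝ (Fin 3) → EuclideanSpace ℝ (Fin 3))
      (q : EuclideanSpace ℝ (Fin 3) → ℝ), ContDiff ℝ (⊤ : ℕ∞) w → ContDiff ℝ (⊤ : ℕ∞) q →
      Literature.Analysis.FluidPDE.VectorCalculus.IsDivFree w → (∀ x, ‖w x‖ ≤ M) →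
      (∀ x, ‖fderiv ℝ q x‖ ≤ L) →
      (∀ x, Laplacian.laplacian q x =
        -Literature.Analysis.FluidPDE.VectorCalculus.divergence (Literature.Analysis.FluidPDE.convect w w) x) →
      ∃ a : EuclideanSpace ℝ (Fin 3), (∀ x₀ : EuclideanSpace ℝ (Fin 3), ∃ (c : ℝ)
        (p₁ p₂ : EuclideanSpace ℝ (Fin 3) → ℝ), (∀ x ∈ Metric.ball x₀ 2, q x = c + inner ℝ a x + p₁ x + p₂ x) ∧
        MeasureTheory.MemLp p₁ 2 MeasureTheory.volume ∧
        ∫ x, p₁ x ^ 2 ≤ c₀ * M ^ 2 * ∫ x in Metric.ball x₀ 4, ‖w x‖ ^ 2 ∧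
        ∀ x ∈ Metric.ball x₀ 2, DifferentiableAt ℝ p₂ x ∧
          ‖fderiv ℝ p₂ x‖ ≤ c₀ * ∫ y in (Metric.ball x₀ 3)ᶜ, ‖w y‖ ^ 2 / ‖y - x₀‖ ^ 4) ∧
        ∀ r : ℝ, 1 ≤ r → ‖(∫ x, ((⟨1, 2, zero_lt_one, one_lt_two⟩ :
          ContDiffBump (0 : EuclideanSpace ℝ (Fin 3))) : EuclideanSpace ℝ (Fin 3) → ℝ) (r⁻¹ • x))⁻¹ •
          (∫ x, (((⟨1, 2, zero_lt_one, one_lt_two⟩ : ContDiffBump (0 : EuclideanSpace ℝ (Fin 3))) :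
            EuclideanSpace ℝ (Fin 3) → ℝ) (r⁻¹ • x)) • gradient q x) - a‖ ≤ c₀ * M ^ 2 / r) :
    ∀ (C K : ℝ), ∃ D₀ : ℝ,
      ∀ w : ℝ → EuclideanSpace ℝ (Fin 3) → EuclideanSpace ℝ (Fin 3), IsTypeIAncientMild C w →
        (∀ t < 0, ∀ (x₀ : EuclideanSpace ℝ (Fin 3)) (R : ℝ), 0 < R →
          ∫ x in ball x₀ R, ‖w t x‖ ^ 2 ≤ K * R) →
        ∀ T ∈ Ioc (0 : ℝ) 1, ∃ q : ℝ → EuclideanSpace ℝ (Fin 3) → ℝ,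
          IsSuitableWeakSolutionInBall 1 0 (fun s y => w (s - T) y) q ∧
          ∫⁻ z in parabolicCylinder 1 (0 : ℝ × EuclideanSpace ℝ (Fin 3)), ‖q z.1 z.2‖ₑ ^ (3 / 2 : ℝ) ≤
            ENNReal.ofReal D₀ := by
  intro C K
  obtain ⟨c₀, hc₀, hHA⟩ := hHA
  obtain ⟨cS, hcS0, hS⟩ := stub_fplFarShell
  -- the near/far structure of the window pressure on `(-3, 0)` at the centre `0`, for every `w ∈ A_C`
  have hNF : ∀ w : ℝ → EuclideanSpace ℝ (Fin 3) → EuclideanSpace ℝ (Fin 3), IsTypeIAncientMild C w →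
      ∃ p : ℝ → EuclideanSpace ℝ (Fin 3) → ℝ, IsClassicalNSSolutionOn (Ioo (-3) 0) 1 0 w p ∧
        ∀ τ ∈ Ioo (-3 : ℝ) 0, ∃ (c : ℝ) (p₁ p₂ : EuclideanSpace ℝ (Fin 3) → ℝ),
          (∀ x ∈ ball (0 : EuclideanSpace ℝ (Fin 3)) 2, p τ x = c + p₁ x + p₂ x) ∧ MemLp p₁ 2 volume ∧
          ∫ x, p₁ x ^ 2 ≤ c₀ * (C ^ 2 / (-τ)) * ∫ x in ball (0 : EuclideanSpace ℝ (Fin 3)) 4, ‖w τ x‖ ^ 2 ∧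
          ∀ x ∈ ball (0 : EuclideanSpace ℝ (Fin 3)) 2, DifferentiableAt ℝ p₂ x ∧
            ‖fderiv ℝ p₂ x‖ ≤ c₀ * ∫ y in (ball (0 : EuclideanSpace ℝ (Fin 3)) 3)ᶜ,
              ‖w τ y‖ ^ 2 / ‖y - (0 : EuclideanSpace ℝ (Fin 3))‖ ^ 4 := by
    intro w hw
    obtain ⟨p, hp, h⟩ := nearFar_window_of_parts hc₀ stub_fplPressureGradientBound hHA stub_fplPinning
      stub_fplMeanDisplacement hw (t₀ := (-3 : ℝ)) (by norm_num)
    exact ⟨p, hp, fun τ hτ => h τ hτ 0⟩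
  exact pressurePackage_of_nearFar (C := C) (K := K) hc₀ hcS0 (hS stub_fplCovering) hNF

end Summit.NavierStokesRegularity.NavierStokesRegularity.Theorems.SymmetryModuliCountForcedSymmetry

end
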